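import Summits.QuantumFields.YangMills.Theorems.BalabanUVNodesN15TwoSpacingGluingDefect
import HarnessLib

/-!
# THE GLUING STEP AT TWO LATTICE SPACINGS, III: the parametrix pair `(G₀, R)` FROM CUBE-LOCALIZED PROPAGATORS and a quadratic partition `Σ_□ h_□² = 1` —
# (2.91) DERIVED from per-cube locality, the bounded-overlap majorants of `G₀ = Σ_□ M_h G_□ M_h` and `R = −Σ_□ [Δ_a, M_h]G_□M_h`, and their η-DEFECTS from the
# cubes' two-grid defects + the partition's fits; hence the η-defect of the GLUED GLOBAL PROPAGATOR with every letter cube-level (dag-n15-c g11, FILE 45; N15 = NE2, s1)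

Cell `pub-ymgap`, seat `pub-ymgap-dag-n15-c` (R134 (a); HUMAN RULING D-0062), generation 11.  `bears_on: R4∕N15 · K3⁷ SpineGivenEndpointR13SepCoPH (stmt-QuantumFields-20544)`.
Filed `--supports stmt-QuantumFields-20544 --as helper` — COUNT-NEUTRAL.  Three plumbing `def`s (`parametrix`, `commOp`, `remainder`), the rest theorems; 0 `sorry`.  Imports BY NAME
FILES 43∕44 `…N15TwoSpacingGluing(Defect)` (`glueInv`, `lap_comp_glueInv`, `hasMaj_glueInv`, `hasMaj_idef_glueInv`; through them n15-b A1, lit `B11SectG`, `T4EtaRateDefect`,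
`T4EtaRateCoeffDefect` (`hasMaj_mulOp`, `hasMaj_idef_mulOp`, `diagK`), `B6Prop26Gluing` (`mulOp`, `ind`, `abs_le_one_of_sum_sq`), `…N15.DerivDefect.sum_diagK_mul`∕`sum_mul_diagK`);
nothing in the tree is modified.

WHY.  [Balaban1984PropagatorsII] p. 239 (verbatim): *«We form an approximation of G taking as usual G₀ = Σ_{□∈𝒟} h_□G_□h_□.  Using the formulas (1.126)–(1.128), we get Δ_aG₀ =
I − Σ_{□,□′∈𝒟} K_{□,□′}G_{□′}h_{□′} = I − R, (2.91)»*, p. 229 *«Σ_□ h_□² = 1 (2.36)»*, p. 247 *«|(K_{□,□′}G_{□′}h_{□′}J)(x)| ≤ O(M^{−1})e^{−½δ₂d(y,y′)}|J| (2.134) … this together with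
(2.91) implies |(RJ)(x)| ≤ O(M^{−1})e^{−½δ₂d(y,y′)}|J| (2.135)»* — in the tree at ONE spacing as lit `B6Prop26Gluing` (square `HasMajorant` currency, (2.133)∕(2.134) displayed).  FILES 43∕44
resum an ABSTRACT parametrix pair at two spacings.  THIS FILE builds the pair from CUBE data in the rectangular `HasMaj` currency the η-defect needs, and DERIVES (2.91) from the
one structural fact it rests on — each cube propagator inverts `Δ_a` where its partition function lives (`M_{h_□}∘Δ_a∘G_□ = M_{h_□}`, Dirichlet localization + locality of `Δ_a` in the
print) — with the remainder `R = −Σ_□ [Δ_a, M_{h_□}]∘G_□∘M_{h_□}` EXACTLY (the (2.92) commutator terms; the print's off-diagonal (2.93) terms of the non-local `∂P∂*` are part of the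
displayed per-cube letter here).

WHAT (lattices `X` (blocks `blk`), `X′` (blocks `blk ∘ π`), cube index `ι`, reach sets `S_□ ⊆ 𝔅` with overlap `Σ_□ 1_{S_□}(y) ≤ N_ov`):
* §1 block-majorant helpers: `hasMaj_diag_comp` ∕ `hasMaj_comp_diag` (a diagonal factor multiplies the kernel pointwise — NO rate loss), `hasMaj_fsum`, ★ `hasMaj_sum_overlap` (terms carrying
  `1_{S_□}(y)` sum to `N_ov·K` — lit `B6Prop26Gluing.hasMajorant_sum_overlap` in the rectangular currency);
* §2 defs `parametrix h G := Σ_□ M_{h_□}∘G_□∘M_{h_□}`, `commOp Δ a := Δ∘M_a − M_a∘Δ`, `remainder Δ h G := −Σ_□ commOp Δ h_□ ∘ G_□ ∘ M_{h_□}`; `mulOp_comp_mulOp`, `sum_mulOp_sq` ((2.36) ⟹ `Σ_□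
  M_{h_□}² = 1`), ★★ **`lap_comp_parametrix`** — (2.91) `Δ_a∘G₀ = 1 − R` DERIVED from (2.36) and the per-cube locality `M_{h_□}∘Δ_a∘G_□ = M_{h_□}`; ★ `lap_comp_glued` (hence FILE 43's
  `glueInv (parametrix h G) (remainder Δ h G)` IS the inverse of `Δ_a`, two-sided);
* §3 majorants from cube letters (`G_□ ≤ 1_{S_□}(y)1_{S_□}(y′)·βe^{−δd}`, `[Δ_a, M_{h_□}]G_□ ≤ 1_{S_□}(y)1_{S_□}(y′)·θ₀e^{−δd}` — the (2.133)∕(2.134) shapes, `θ₀ = O(M⁻¹)`): ★ `hasMaj_parametrix`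
  (`G₀ ≤ N_ov β e^{−δd}`), ★ `hasMaj_remainder` (`R ≤ N_ov θ₀ e^{−δd}` — (2.135) with its `O(M⁻¹) = N_ov·θ₀` explicit);
* §4 η-defects from cube defects (`𝔇(G_□′,G_□) ≤ 1·1·me^{−δd}`, `𝔇(K_□′,K_□) ≤ 1·1·re^{−δd}`) + partition fits (`|h′_□ − h_□∘π| ≤ o`): ★★ `hasMaj_idef_parametrix` (`≤ N_ov(2βo + m)e^{−δd}`,
  Leibniz ×2 + `hasMaj_idef_mulOp`), ★★ `hasMaj_idef_remainder` (`≤ N_ov(θ₀o + r)e^{−δd}`);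
* §5 ★★★ **`hasMaj_idef_glued_of_cubes`** — FILE 44's ★★★ with EVERY letter cube-level ∕ partition-level: the η-defect of the glued global propagator obeys
  `C(β, m, o, r, θ₀, N_ov, c_r)·e^{−(δ−2σ)d}` under the ONE smallness `N_ov·θ₀·c_r < 1` — with `θ₀ = κ₀∕M` the `M ≥ M₁` guard of [B9] Thm 3.1 (`hasMaj_glued_of_cubes` for the majorant).

HONEST FRAMING ∕ LIMITS.  Operator algebra + block-majorant bookkeeping ([B6] (2.36) p. 229, (2.91)–(2.93) p. 239, (2.133)–(2.136) p. 247, [B9] p. 399 = MECHANISM; nothing of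
[B6]∕[B9] asserted).  DISPLAYED, located, not claimed: the cube propagators' (2.133)-shaped majorants and two-grid defects at BOTH spacings (the lineage's perturbative device on
Dirichlet cubes in the cube's (3.35) gauge — [B4] §5; no tree producer), the commutator letters (2.134) and their defects (Leibniz on `[Δ_a, M_h] = −M_{Δh} − Σ_μ M_{∇_μh}∇_μ − …`,
(1.126)–(1.128): cube entries 0∕1 + `|∇h| ≤ O(M⁻¹)` — the sequel), the partition fits, the per-cube locality and (2.36).  NE2⁺ NOT PRINTED, NOT proved; N15 NOT discharged; counts of
record UNMOVED (typed 28∕28 · discharged 5∕27); one finite 𝕋⁴ at fixed ε — NOT infinite volume, NOT OS on ℝ⁴, NOT a mass gap, NOT Clay; R4 closes the conditional finite-𝕋⁴ rung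
`BalabanLadder.UV` only.  Restate-immune (no Theses import).
-/

noncomputable section

namespace Summit.QuantumFields.YangMills.BalabanUVNodes.N15.Gluing

open Literature.MathematicalPhysics.QuantumFieldTheory.Balaban1983to89
open Literature.MathematicalPhysics.QuantumFieldTheory.Balaban1983to89.B11SectG (BlockNorm HasMaj RowSum hasMaj_comp hasMaj_zero)
open Literature.MathematicalPhysics.QuantumFieldTheory.Balaban1983to89.T4EtaRateDefect (idef idef_apply idef_comp)
open Literature.MathematicalPhysics.QuantumFieldTheory.Balaban1983to89.T4EtaRateCoeffDefect (pull pull_apply diagK diagK_nonneg hasMaj_mulOp hasMaj_idef_mulOp)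
open Literature.MathematicalPhysics.QuantumFieldTheory.Balaban1983to89.B6RandomWalk (Triangle254)
open Literature.MathematicalPhysics.QuantumFieldTheory.Balaban1983to89.B6Prop26Gluing (mulOp mulOp_apply ind ind_nonneg ind_le_one abs_le_one_of_sum_sq)
open Summit.QuantumFields.YangMills.BalabanUVNodes.N15.DerivDefect (sum_diagK_mul sum_mul_diagK)

/-! ## §1 Block-majorant helpers: diagonal factors, finite sums, bounded overlap -/

section Helpers

variable {g : B6.Geometry} {F₁ F₃ : Type} [AddCommGroup F₁] [Module ℝ F₁] [AddCommGroup F₃] [Module ℝ F₃] {X₂ : Type} [Fintype X₂] (blk₂ : X₂ → g.Site)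

/-- A DIAGONAL factor on the left multiplies the kernel pointwise: `M ≤ diagK m`, `T ≤ K` ⟹ `M∘T ≤ m(y)·K(y,y′)` — no row sum, no rate loss. [folklore] -/
theorem hasMaj_diag_comp {b₁ : BlockNorm g F₁} {b₃ : BlockNorm g F₃} {T₁ : (X₂ → ℝ) →ₗ[ℝ] F₃} {T₂ : F₁ →ₗ[ℝ] (X₂ → ℝ)} {m : g.Site → ℝ}
    {K : g.Site → g.Site → ℝ} (hm : ∀ y, 0 ≤ m y) (h₁ : HasMaj (BlockNorm.ofBlocks g blk₂) b₃ T₁ (diagK m)) (h₂ : HasMaj b₁ (BlockNorm.ofBlocks g blk₂) T₂ K) :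
    HasMaj b₁ b₃ (T₁ ∘ₗ T₂) (fun y y' => m y * K y y') := by
  refine (hasMaj_comp h₁ h₂ (diagK_nonneg hm)).mono fun a b => le_of_eq ?_
  rw [show (BlockNorm.ofBlocks g blk₂).κ = 1 from rfl]
  simp only [one_mul]
  exact sum_diagK_mul m (fun y'' => K y'' b) a

/-- A DIAGONAL factor on the right multiplies the kernel pointwise: `T ≤ K ≥ 0`, `M ≤ diagK m` ⟹ `T∘M ≤ K(y,y′)·m(y′)`. [folklore] -/
theorem hasMaj_comp_diag {b₁ : BlockNorm g F₁} {b₃ : BlockNorm g F₃} {T₁ : (X₂ → ℝ) →ₗ[ℝ] F₃} {T₂ : F₁ →ₗ[ℝ] (X₂ → ℝ)} {m : g.Site → ℝ}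
    {K : g.Site → g.Site → ℝ} (hK : ∀ a b, 0 ≤ K a b) (h₁ : HasMaj (BlockNorm.ofBlocks g blk₂) b₃ T₁ K) (h₂ : HasMaj b₁ (BlockNorm.ofBlocks g blk₂) T₂ (diagK m)) :
    HasMaj b₁ b₃ (T₁ ∘ₗ T₂) (fun y y' => K y y' * m y') := by
  refine (hasMaj_comp h₁ h₂ hK).mono fun a b => le_of_eq ?_
  rw [show (BlockNorm.ofBlocks g blk₂).κ = 1 from rfl]
  simp only [one_mul]
  exact sum_mul_diagK m (fun y'' => K a y'') b

variable {b₁ : BlockNorm g F₁} {b₃ : BlockNorm g F₃}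

/-- Majorants of a finite sum of operators add termwise. [cite: Balaban1984PropagatorsII, p.232 («A summation preserves it also»)] -/
theorem hasMaj_fsum {ι : Type} (s : Finset ι) (T : ι → F₁ →ₗ[ℝ] F₃) (K : ι → g.Site → g.Site → ℝ) (h : ∀ i ∈ s, HasMaj b₁ b₃ (T i) (K i)) :
    HasMaj b₁ b₃ (∑ i ∈ s, T i) (fun a b => ∑ i ∈ s, K i a b) := by
  classical
  induction s using Finset.induction_on with
  | empty => simpa using hasMaj_zero b₁ b₃
  | insert i s hi ih =>
      have key := (h i (Finset.mem_insert_self i s)).add (ih fun j hj => h j (Finset.mem_insert_of_mem hj))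
      rw [Finset.sum_insert hi]
      refine key.mono fun a b => le_of_eq ?_
      rw [Finset.sum_insert hi]

/-- ★ **BOUNDED OVERLAP** (the double-counting hidden in [B6]'s «this together with (2.91) implies (2.135)»): if every term's majorant carries the indicator `1_{S_□}(y)` of
its cube's reach and each block meets at most `N_ov` reaches, the sum has majorant `N_ov·K`. [cite: Balaban1984PropagatorsII, (2.134)–(2.135) p.247 (mechanism)] -/
theorem hasMaj_sum_overlap {ι : Type} [Fintype ι] (T : ι → F₁ →ₗ[ℝ] F₃) (S : ι → Set g.Site) (K : g.Site → g.Site → ℝ) (Nov : ℝ) (hK : ∀ a b, 0 ≤ K a b)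
    (h : ∀ i, HasMaj b₁ b₃ (T i) (fun a b => ind (S i) a * K a b)) (hN : ∀ a, ∑ i, ind (S i) a ≤ Nov) :
    HasMaj b₁ b₃ (∑ i, T i) (fun a b => Nov * K a b) := by
  refine (hasMaj_fsum Finset.univ T _ fun i _ => h i).mono fun a b => ?_
  rw [← Finset.sum_mul]
  exact mul_le_mul_of_nonneg_right (hN a) (hK a b)

end Helpers

/-! ## §2 The parametrix pair from cubes; (2.91) DERIVED from (2.36) and per-cube locality -/

section Pair

variable {X : Type} {ι : Type} [Fintype ι]

/-- **THE PARAMETRIX** `G₀ = Σ_□ M_{h_□}∘G_□∘M_{h_□}` of a family of cube-localized propagators `G_□` and partition functions `h_□`. [cite: Balaban1984PropagatorsII, p.239 («G₀ = Σ_{□∈𝒟} h_□G_□h_□»)] -/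
def parametrix (h : ι → X → ℝ) (G : ι → (X → ℝ) →ₗ[ℝ] (X → ℝ)) : (X → ℝ) →ₗ[ℝ] (X → ℝ) := ∑ i, mulOp (h i) ∘ₗ G i ∘ₗ mulOp (h i)

/-- THE COMMUTATOR `[Δ, M_a] = Δ∘M_a − M_a∘Δ` of an operator with a multiplication (the left brackets (2.92) of the remainder; for the lattice Laplacian it is the first-order
operator of (1.126)–(1.128)). [cite: Balaban1984PropagatorsII, (2.92) p.239 (shape)] -/
def commOp (Δ : (X → ℝ) →ₗ[ℝ] (X → ℝ)) (a : X → ℝ) : (X → ℝ) →ₗ[ℝ] (X → ℝ) := Δ ∘ₗ mulOp a - mulOp a ∘ₗ Δ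

/-- **THE REMAINDER** `R = −Σ_□ [Δ_a, M_{h_□}]∘G_□∘M_{h_□}` of the parametrix. [cite: Balaban1984PropagatorsII, (2.91)–(2.92) p.239 (shape)] -/
def remainder (Δ : (X → ℝ) →ₗ[ℝ] (X → ℝ)) (h : ι → X → ℝ) (G : ι → (X → ℝ) →ₗ[ℝ] (X → ℝ)) : (X → ℝ) →ₗ[ℝ] (X → ℝ) :=
  -∑ i, commOp Δ (h i) ∘ₗ G i ∘ₗ mulOp (h i)

/-- `M_a∘M_b = M_{ab}`. [folklore] -/
theorem mulOp_comp_mulOp (a b : X → ℝ) : mulOp a ∘ₗ mulOp b = mulOp (a * b) := by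
  refine LinearMap.ext fun f => funext fun x => ?_
  simp only [LinearMap.comp_apply, mulOp_apply, Pi.mul_apply]
  ring

/-- **(2.36) ⟹ `Σ_□ M_{h_□}∘M_{h_□} = 1`.** [cite: Balaban1984PropagatorsII, (2.36) p.229] -/
theorem sum_mulOp_sq (h : ι → X → ℝ) (h236 : ∀ x, ∑ i, h i x ^ 2 = 1) : ∑ i, mulOp (h i) ∘ₗ mulOp (h i) = LinearMap.id := by
  refine LinearMap.ext fun f => funext fun x => ?_
  simp only [LinearMap.coe_sum, Finset.sum_apply, LinearMap.comp_apply, mulOp_apply, LinearMap.id_apply]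
  calc ∑ i, h i x * (h i x * f x) = (∑ i, h i x ^ 2) * f x := by rw [Finset.sum_mul]; exact Finset.sum_congr rfl fun i _ => by ring
    _ = f x := by rw [h236 x, one_mul]

/-- ONE CUBE: `Δ∘(M_hG_□M_h) = M_h∘M_h + [Δ, M_h]∘G_□∘M_h` whenever `M_h∘Δ∘G_□ = M_h` (the cube propagator inverts `Δ` where `h` lives). [cite: Balaban1984PropagatorsII, (2.91) p.239 (mechanism, «Using the formulas (1.126)–(1.128)»)] -/
theorem lap_comp_cube {Δ G : (X → ℝ) →ₗ[ℝ] (X → ℝ)} {a : X → ℝ} (hloc : mulOp a ∘ₗ Δ ∘ₗ G = mulOp a) :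
    Δ ∘ₗ (mulOp a ∘ₗ G ∘ₗ mulOp a) = mulOp a ∘ₗ mulOp a + commOp Δ a ∘ₗ G ∘ₗ mulOp a := by
  have h1 : Δ ∘ₗ mulOp a = mulOp a ∘ₗ Δ + commOp Δ a := by rw [commOp]; abel
  calc Δ ∘ₗ (mulOp a ∘ₗ G ∘ₗ mulOp a) = (Δ ∘ₗ mulOp a) ∘ₗ (G ∘ₗ mulOp a) := by rw [LinearMap.comp_assoc]
    _ = (mulOp a ∘ₗ Δ ∘ₗ G) ∘ₗ mulOp a + commOp Δ a ∘ₗ G ∘ₗ mulOp a := by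
        rw [h1, LinearMap.add_comp, LinearMap.comp_assoc, LinearMap.comp_assoc, LinearMap.comp_assoc]
    _ = mulOp a ∘ₗ mulOp a + commOp Δ a ∘ₗ G ∘ₗ mulOp a := by rw [hloc]

/-- ★★ **(2.91) DERIVED**: `Δ_a∘G₀ = 1 − R` from the quadratic partition of unity (2.36) and the per-cube locality `M_{h_□}∘Δ_a∘G_□ = M_{h_□}`.
[cite: Balaban1984PropagatorsII, (2.91) p.239, (2.36) p.229] -/
theorem lap_comp_parametrix {Δ : (X → ℝ) →ₗ[ℝ] (X → ℝ)} {h : ι → X → ℝ} {G : ι → (X → ℝ) →ₗ[ℝ] (X → ℝ)} (h236 : ∀ x, ∑ i, h i x ^ 2 = 1)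
    (hloc : ∀ i, mulOp (h i) ∘ₗ Δ ∘ₗ G i = mulOp (h i)) :
    Δ ∘ₗ parametrix h G = LinearMap.id - remainder Δ h G := by
  have hsum : Δ ∘ₗ parametrix h G = ∑ i, Δ ∘ₗ (mulOp (h i) ∘ₗ G i ∘ₗ mulOp (h i)) :=
    LinearMap.ext fun v => by simp only [parametrix, LinearMap.comp_apply, LinearMap.coe_sum, Finset.sum_apply, map_sum]
  rw [hsum, remainder, sub_neg_eq_add, ← sum_mulOp_sq h h236, ← Finset.sum_add_distrib]
  exact Finset.sum_congr rfl fun i _ => lap_comp_cube (hloc i)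

/-- ★ **THE GLUED OPERATOR IS THE INVERSE OF `Δ_a`** (both sides, finite dimension): FILE 43's `glueInv (parametrix h G) (remainder Δ h G)` under (2.36), per-cube locality and the
unit hypothesis on `1 − [R]`. [cite: Balaban1984PropagatorsII, (2.91) p.239 + p.247 («G = G₀(I − R)⁻¹»: mechanism)] -/
theorem lap_comp_glued [Fintype X] [DecidableEq X] {Δ : (X → ℝ) →ₗ[ℝ] (X → ℝ)} {h : ι → X → ℝ} {G : ι → (X → ℝ) →ₗ[ℝ] (X → ℝ)} (h236 : ∀ x, ∑ i, h i x ^ 2 = 1)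
    (hloc : ∀ i, mulOp (h i) ∘ₗ Δ ∘ₗ G i = mulOp (h i)) (hunit : IsUnit (1 - LinearMap.toMatrix' (remainder Δ h G))) :
    Δ ∘ₗ glueInv (parametrix h G) (remainder Δ h G) = LinearMap.id ∧ glueInv (parametrix h G) (remainder Δ h G) ∘ₗ Δ = LinearMap.id :=
  ⟨lap_comp_glueInv hunit (lap_comp_parametrix h236 hloc), glueInv_comp_lap hunit (lap_comp_parametrix h236 hloc)⟩

end Pair

/-! ## §3 Majorants of the pair from cube letters under bounded overlap ((2.133)∕(2.134) shapes ⟹ (2.135)) -/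

section Majorants

variable {X : Type} [Fintype X] {ι : Type} [Fintype ι] {g : B6.Geometry} (blk : X → g.Site) (S : ι → Set g.Site)

/-- A sandwich `M_a∘T∘M_b` with `|a|, |b| ≤ 1` keeps the (localized) majorant of `T`. [folklore] -/
theorem hasMaj_mulOp_sandwich {T : (X → ℝ) →ₗ[ℝ] (X → ℝ)} {a b : X → ℝ} {K : g.Site → g.Site → ℝ} (hK : ∀ y y', 0 ≤ K y y') (ha : ∀ x, |a x| ≤ 1) (hb : ∀ x, |b x| ≤ 1)
    (hT : HasMaj (BlockNorm.ofBlocks g blk) (BlockNorm.ofBlocks g blk) T K) :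
    HasMaj (BlockNorm.ofBlocks g blk) (BlockNorm.ofBlocks g blk) (mulOp a ∘ₗ T ∘ₗ mulOp b) K := by
  have hMa := hasMaj_mulOp (g := g) blk (m := fun _ => (1 : ℝ)) (fun _ => zero_le_one) ha
  have hMb := hasMaj_mulOp (g := g) blk (m := fun _ => (1 : ℝ)) (fun _ => zero_le_one) hb
  have h1 := hasMaj_comp_diag blk hK hT hMb
  have h2 := hasMaj_diag_comp blk (fun _ => zero_le_one) hMa h1
  refine h2.mono fun y y' => le_of_eq ?_
  ring

/-- ★ **THE PARAMETRIX DECAYS**: `G_□ ≤ 1_{S_□}(y)1_{S_□}(y′)·βe^{−δd}` (the (2.133) shape, localized to the cube's reach), `|h_□| ≤ 1`, overlap `≤ N_ov` ⟹ `G₀ ≤ N_ov·β·e^{−δd}`.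
[cite: Balaban1984PropagatorsII, (2.133) p.247 (shape) + p.247 («Reasoning in the same way …»: mechanism)] -/
theorem hasMaj_parametrix {h : ι → X → ℝ} {G : ι → (X → ℝ) →ₗ[ℝ] (X → ℝ)} {β δ Nov : ℝ} (hβ : 0 ≤ β) (hh : ∀ i x, |h i x| ≤ 1) (hN : ∀ a, ∑ i, ind (S i) a ≤ Nov)
    (hG : ∀ i, HasMaj (BlockNorm.ofBlocks g blk) (BlockNorm.ofBlocks g blk) (G i) (fun y y' => ind (S i) y * ind (S i) y' * (β * Real.exp (-(δ * g.dist y y'))))) :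
    HasMaj (BlockNorm.ofBlocks g blk) (BlockNorm.ofBlocks g blk) (parametrix h G) (fun y y' => Nov * β * Real.exp (-(δ * g.dist y y'))) := by
  have hterm : ∀ i, HasMaj (BlockNorm.ofBlocks g blk) (BlockNorm.ofBlocks g blk) (mulOp (h i) ∘ₗ G i ∘ₗ mulOp (h i))
      (fun y y' => ind (S i) y * (β * Real.exp (-(δ * g.dist y y')))) := fun i => by
    refine (hasMaj_mulOp_sandwich blk (fun y y' => ?_) (hh i) (hh i) (hG i)).mono fun y y' => ?_
    · exact mul_nonneg (mul_nonneg (ind_nonneg _ _) (ind_nonneg _ _)) (mul_nonneg hβ (Real.exp_nonneg _))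
    · have h1 := ind_le_one (S i) y'
      have hE : 0 ≤ ind (S i) y * (β * Real.exp (-(δ * g.dist y y'))) := mul_nonneg (ind_nonneg _ _) (mul_nonneg hβ (Real.exp_nonneg _))
      calc ind (S i) y * ind (S i) y' * (β * Real.exp (-(δ * g.dist y y'))) = ind (S i) y' * (ind (S i) y * (β * Real.exp (-(δ * g.dist y y')))) := by ring
        _ ≤ 1 * (ind (S i) y * (β * Real.exp (-(δ * g.dist y y')))) := mul_le_mul_of_nonneg_right h1 hE
        _ = _ := one_mul _
  refine (hasMaj_sum_overlap _ S _ Nov (fun y y' => mul_nonneg hβ (Real.exp_nonneg _)) hterm hN).mono fun y y' => le_of_eq ?_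
  ring

/-- ★ **(2.135): THE REMAINDER IS SMALL**: `[Δ_a, M_{h_□}]∘G_□ ≤ 1_{S_□}(y)1_{S_□}(y′)·θ₀e^{−δd}` (the (2.134) shape; `θ₀ = O(M⁻¹)` in the print), `|h_□| ≤ 1`, overlap `≤ N_ov` ⟹
`R ≤ N_ov·θ₀·e^{−δd}` — the smallness FILE 43 consumes (`N_ov θ₀ c_r < 1`). [cite: Balaban1984PropagatorsII, (2.134)–(2.135) p.247] -/
theorem hasMaj_remainder {Δ : (X → ℝ) →ₗ[ℝ] (X → ℝ)} {h : ι → X → ℝ} {G : ι → (X → ℝ) →ₗ[ℝ] (X → ℝ)} {θ₀ δ Nov : ℝ} (hθ : 0 ≤ θ₀) (hh : ∀ i x, |h i x| ≤ 1)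
    (hN : ∀ a, ∑ i, ind (S i) a ≤ Nov)
    (hKc : ∀ i, HasMaj (BlockNorm.ofBlocks g blk) (BlockNorm.ofBlocks g blk) (commOp Δ (h i) ∘ₗ G i)
      (fun y y' => ind (S i) y * ind (S i) y' * (θ₀ * Real.exp (-(δ * g.dist y y'))))) :
    HasMaj (BlockNorm.ofBlocks g blk) (BlockNorm.ofBlocks g blk) (remainder Δ h G) (fun y y' => Nov * θ₀ * Real.exp (-(δ * g.dist y y'))) := by
  have hterm : ∀ i, HasMaj (BlockNorm.ofBlocks g blk) (BlockNorm.ofBlocks g blk) ((commOp Δ (h i) ∘ₗ G i) ∘ₗ mulOp (h i))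
      (fun y y' => ind (S i) y * (θ₀ * Real.exp (-(δ * g.dist y y')))) := fun i => by
    have hMb := hasMaj_mulOp (g := g) blk (m := fun _ => (1 : ℝ)) (fun _ => zero_le_one) (hh i)
    refine (hasMaj_comp_diag blk (fun y y' => ?_) (hKc i) hMb).mono fun y y' => ?_
    · exact mul_nonneg (mul_nonneg (ind_nonneg _ _) (ind_nonneg _ _)) (mul_nonneg hθ (Real.exp_nonneg _))
    · have h1 := ind_le_one (S i) y'
      have hE : 0 ≤ ind (S i) y * (θ₀ * Real.exp (-(δ * g.dist y y'))) := mul_nonneg (ind_nonneg _ _) (mul_nonneg hθ (Real.exp_nonneg _))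
      calc ind (S i) y * ind (S i) y' * (θ₀ * Real.exp (-(δ * g.dist y y'))) * 1 = ind (S i) y' * (ind (S i) y * (θ₀ * Real.exp (-(δ * g.dist y y')))) := by ring
        _ ≤ 1 * (ind (S i) y * (θ₀ * Real.exp (-(δ * g.dist y y')))) := mul_le_mul_of_nonneg_right h1 hE
        _ = _ := one_mul _
  have hsum := hasMaj_sum_overlap _ S _ Nov (fun y y' => mul_nonneg hθ (Real.exp_nonneg _)) hterm hN
  rw [remainder]
  refine (hsum.neg.congr fun μ => ?_).mono fun y y' => le_of_eq (by ring)
  simp only [LinearMap.neg_apply, LinearMap.coe_sum, Finset.sum_apply, LinearMap.comp_apply]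

end Majorants

/-! ## §4 The η-defects of the pair from the cubes' two-grid defects and the partition's fits -/

section Defects

variable {X X' : Type} [Fintype X] [Fintype X'] {ι : Type} [Fintype ι] {g : B6.Geometry} (blk : X → g.Site) (π : X' → X) (S : ι → Set g.Site)

omit [Fintype X] [Fintype X'] in
/-- The η-defect of a finite sum is the sum of the η-defects. [folklore] -/
theorem idef_fsum (T' : ι → (X' → ℝ) →ₗ[ℝ] (X' → ℝ)) (T : ι → (X → ℝ) →ₗ[ℝ] (X → ℝ)) :
    idef (pull π) (pull π) (∑ i, T' i) (∑ i, T i) = ∑ i, idef (pull π) (pull π) (T' i) (T i) := by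
  refine LinearMap.ext fun f => ?_
  simp only [idef_apply, LinearMap.coe_sum, Finset.sum_apply, map_sum, Finset.sum_sub_distrib]

omit [Fintype X] [Fintype X'] [Fintype ι] in
/-- The η-defect of a negated pair is the negated η-defect. [folklore] -/
theorem idef_neg (T' : (X' → ℝ) →ₗ[ℝ] (X' → ℝ)) (T : (X → ℝ) →ₗ[ℝ] (X → ℝ)) : idef (pull π) (pull π) (-T') (-T) = -idef (pull π) (pull π) T' T := by
  refine LinearMap.ext fun f => ?_
  simp only [idef_apply, LinearMap.neg_apply, map_neg, neg_sub_neg, neg_sub]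

omit [Fintype X] [Fintype X'] [Fintype ι] in
/-- LEIBNIZ FOR THE SANDWICH: `𝔇(M_{a′}T′M_{b′}, M_aTM_b) = M_{a′}∘T′∘𝔇(M_{b′},M_b) + M_{a′}∘𝔇(T′,T)∘M_b + 𝔇(M_{a′},M_a)∘T∘M_b`. [folklore] -/
theorem idef_sandwich (a' b' : X' → ℝ) (a b : X → ℝ) (T' : (X' → ℝ) →ₗ[ℝ] (X' → ℝ)) (T : (X → ℝ) →ₗ[ℝ] (X → ℝ)) :
    idef (pull π) (pull π) (mulOp a' ∘ₗ T' ∘ₗ mulOp b') (mulOp a ∘ₗ T ∘ₗ mulOp b) =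
      mulOp a' ∘ₗ T' ∘ₗ idef (pull π) (pull π) (mulOp b') (mulOp b) + mulOp a' ∘ₗ idef (pull π) (pull π) T' T ∘ₗ mulOp b +
        idef (pull π) (pull π) (mulOp a') (mulOp a) ∘ₗ T ∘ₗ mulOp b := by
  rw [idef_comp (pull π) (pull π) (pull π), idef_comp (pull π) (pull π) (pull π), LinearMap.comp_add]

/-- ★★ **THE η-DEFECT OF THE PARAMETRIX** from the cubes' two-grid defects `𝔇(G_□′, G_□) ≤ 1_{S_□}(y)1_{S_□}(y′)·me^{−δd}`, the fine cubes' majorants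
`G_□′ ≤ 1·1·βe^{−δd}`, the coarse ones', and the partition's fits `|h′_□ − h_□∘π| ≤ o`: `𝔇(G₀′, G₀) ≤ N_ov·(2βo + m)·e^{−δd}` (Leibniz on the sandwich; diagonal factors cost no rate).
[cite: Balaban1984PropagatorsII, (2.91) p.239, (2.133) p.247 (shapes); Balaban1985BackgroundPropagators, Thm 3.14 pp.426–427 (difference template)] -/
theorem hasMaj_idef_parametrix {h : ι → X → ℝ} {h' : ι → X' → ℝ} {G : ι → (X → ℝ) →ₗ[ℝ] (X → ℝ)} {G' : ι → (X' → ℝ) →ₗ[ℝ] (X' → ℝ)} {β m o δ Nov : ℝ}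
    (hβ : 0 ≤ β) (hm : 0 ≤ m) (ho : 0 ≤ o) (hh : ∀ i x, |h i x| ≤ 1) (hh' : ∀ i x', |h' i x'| ≤ 1) (hfit : ∀ i x', |h' i x' - h i (π x')| ≤ o)
    (hN : ∀ a, ∑ i, ind (S i) a ≤ Nov)
    (hG : ∀ i, HasMaj (BlockNorm.ofBlocks g blk) (BlockNorm.ofBlocks g blk) (G i) (fun y y' => ind (S i) y * ind (S i) y' * (β * Real.exp (-(δ * g.dist y y')))))
    (hG' : ∀ i, HasMaj (BlockNorm.ofBlocks g (blk ∘ π)) (BlockNorm.ofBlocks g (blk ∘ π)) (G' i)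
      (fun y y' => ind (S i) y * ind (S i) y' * (β * Real.exp (-(δ * g.dist y y')))))
    (hDG : ∀ i, HasMaj (BlockNorm.ofBlocks g blk) (BlockNorm.ofBlocks g (blk ∘ π)) (idef (pull π) (pull π) (G' i) (G i))
      (fun y y' => ind (S i) y * ind (S i) y' * (m * Real.exp (-(δ * g.dist y y'))))) :
    HasMaj (BlockNorm.ofBlocks g blk) (BlockNorm.ofBlocks g (blk ∘ π)) (idef (pull π) (pull π) (parametrix h' G') (parametrix h G))
      (fun y y' => Nov * (2 * β * o + m) * Real.exp (-(δ * g.dist y y'))) := by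
  have hE : ∀ y y' : g.Site, 0 ≤ Real.exp (-(δ * g.dist y y')) := fun _ _ => Real.exp_nonneg _
  have hterm : ∀ i, HasMaj (BlockNorm.ofBlocks g blk) (BlockNorm.ofBlocks g (blk ∘ π))
      (idef (pull π) (pull π) (mulOp (h' i) ∘ₗ G' i ∘ₗ mulOp (h' i)) (mulOp (h i) ∘ₗ G i ∘ₗ mulOp (h i)))
      (fun y y' => ind (S i) y * ((2 * β * o + m) * Real.exp (-(δ * g.dist y y')))) := by
    intro i
    have hMa := hasMaj_mulOp (g := g) blk (m := fun _ => (1 : ℝ)) (fun _ => zero_le_one) (hh i)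
    have hMa' := hasMaj_mulOp (g := g) (blk ∘ π) (m := fun _ => (1 : ℝ)) (fun _ => zero_le_one) (hh' i)
    have hDM := hasMaj_idef_mulOp (g := g) blk π (o := fun _ => o) (fun _ => ho) (fun x' => hfit i x')
    have hnn : ∀ (c : ℝ), 0 ≤ c → ∀ y y' : g.Site, 0 ≤ ind (S i) y * ind (S i) y' * (c * Real.exp (-(δ * g.dist y y'))) :=
      fun c hc y y' => mul_nonneg (mul_nonneg (ind_nonneg _ _) (ind_nonneg _ _)) (mul_nonneg hc (hE y y'))
    -- term 1: M_{h′} ∘ G′ ∘ 𝔇(M_{h′}, M_h)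
    have t1 := hasMaj_diag_comp (blk ∘ π) (fun _ => zero_le_one) hMa' (hasMaj_comp_diag (blk ∘ π) (hnn β hβ) (hG' i) hDM)
    -- term 2: M_{h′} ∘ 𝔇(G′, G) ∘ M_h
    have t2 := hasMaj_diag_comp (blk ∘ π) (fun _ => zero_le_one) hMa' (hasMaj_comp_diag blk (hnn m hm) (hDG i) hMa)
    -- term 3: 𝔇(M_{h′}, M_h) ∘ G ∘ M_h
    have t3 := hasMaj_diag_comp blk (fun _ => ho) hDM (hasMaj_comp_diag blk (hnn β hβ) (hG i) hMa)
    rw [idef_sandwich]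
    refine ((t1.add t2).add t3).mono fun y y' => ?_
    have h1 := ind_le_one (S i) y'
    have h0 : 0 ≤ ind (S i) y * ((2 * β * o + m) * Real.exp (-(δ * g.dist y y'))) :=
      mul_nonneg (ind_nonneg _ _) (mul_nonneg (by positivity) (hE y y'))
    calc 1 * (ind (S i) y * ind (S i) y' * (β * Real.exp (-(δ * g.dist y y'))) * o) +
          1 * (ind (S i) y * ind (S i) y' * (m * Real.exp (-(δ * g.dist y y'))) * 1) +
          o * (ind (S i) y * ind (S i) y' * (β * Real.exp (-(δ * g.dist y y'))) * 1)
        = ind (S i) y' * (ind (S i) y * ((2 * β * o + m) * Real.exp (-(δ * g.dist y y')))) := by ring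
      _ ≤ 1 * (ind (S i) y * ((2 * β * o + m) * Real.exp (-(δ * g.dist y y')))) := mul_le_mul_of_nonneg_right h1 h0
      _ = _ := one_mul _
  rw [parametrix, parametrix, idef_fsum]
  refine (hasMaj_sum_overlap _ S _ Nov (fun y y' => mul_nonneg (by positivity) (hE y y')) hterm hN).mono fun y y' => le_of_eq ?_
  ring

/-- ★★ **THE η-DEFECT OF THE REMAINDER** from the commutator pieces' letters `[Δ_a, M_{h′_□}]G_□′ ≤ 1·1·θ₀e^{−δd}` (fine, the (2.134) shape), their two-grid defects
`𝔇([Δ_a′, M_{h′_□}]G_□′, [Δ_a, M_{h_□}]G_□) ≤ 1·1·re^{−δd}` and the partition's fits: `𝔇(R′, R) ≤ N_ov·(θ₀o + r)·e^{−δd}`. [cite: Balaban1984PropagatorsII, (2.134)–(2.135) p.247 (shapes)] -/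
theorem hasMaj_idef_remainder {Δ : (X → ℝ) →ₗ[ℝ] (X → ℝ)} {Δ' : (X' → ℝ) →ₗ[ℝ] (X' → ℝ)} {h : ι → X → ℝ} {h' : ι → X' → ℝ} {G : ι → (X → ℝ) →ₗ[ℝ] (X → ℝ)}
    {G' : ι → (X' → ℝ) →ₗ[ℝ] (X' → ℝ)} {θ₀ r o δ Nov : ℝ} (hθ : 0 ≤ θ₀) (hr : 0 ≤ r) (ho : 0 ≤ o) (hh : ∀ i x, |h i x| ≤ 1) (hfit : ∀ i x', |h' i x' - h i (π x')| ≤ o)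
    (hN : ∀ a, ∑ i, ind (S i) a ≤ Nov)
    (hK' : ∀ i, HasMaj (BlockNorm.ofBlocks g (blk ∘ π)) (BlockNorm.ofBlocks g (blk ∘ π)) (commOp Δ' (h' i) ∘ₗ G' i)
      (fun y y' => ind (S i) y * ind (S i) y' * (θ₀ * Real.exp (-(δ * g.dist y y')))))
    (hDK : ∀ i, HasMaj (BlockNorm.ofBlocks g blk) (BlockNorm.ofBlocks g (blk ∘ π)) (idef (pull π) (pull π) (commOp Δ' (h' i) ∘ₗ G' i) (commOp Δ (h i) ∘ₗ G i))
      (fun y y' => ind (S i) y * ind (S i) y' * (r * Real.exp (-(δ * g.dist y y'))))) :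
    HasMaj (BlockNorm.ofBlocks g blk) (BlockNorm.ofBlocks g (blk ∘ π)) (idef (pull π) (pull π) (remainder Δ' h' G') (remainder Δ h G))
      (fun y y' => Nov * (θ₀ * o + r) * Real.exp (-(δ * g.dist y y'))) := by
  have hE : ∀ y y' : g.Site, 0 ≤ Real.exp (-(δ * g.dist y y')) := fun _ _ => Real.exp_nonneg _
  have hterm : ∀ i, HasMaj (BlockNorm.ofBlocks g blk) (BlockNorm.ofBlocks g (blk ∘ π))
      (idef (pull π) (pull π) ((commOp Δ' (h' i) ∘ₗ G' i) ∘ₗ mulOp (h' i)) ((commOp Δ (h i) ∘ₗ G i) ∘ₗ mulOp (h i)))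
      (fun y y' => ind (S i) y * ((θ₀ * o + r) * Real.exp (-(δ * g.dist y y')))) := by
    intro i
    have hMa := hasMaj_mulOp (g := g) blk (m := fun _ => (1 : ℝ)) (fun _ => zero_le_one) (hh i)
    have hDM := hasMaj_idef_mulOp (g := g) blk π (o := fun _ => o) (fun _ => ho) (fun x' => hfit i x')
    have hnn : ∀ (c : ℝ), 0 ≤ c → ∀ y y' : g.Site, 0 ≤ ind (S i) y * ind (S i) y' * (c * Real.exp (-(δ * g.dist y y'))) :=
      fun c hc y y' => mul_nonneg (mul_nonneg (ind_nonneg _ _) (ind_nonneg _ _)) (mul_nonneg hc (hE y y'))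
    have t1 := hasMaj_comp_diag (blk ∘ π) (hnn θ₀ hθ) (hK' i) hDM
    have t2 := hasMaj_comp_diag blk (hnn r hr) (hDK i) hMa
    rw [idef_comp (pull π) (pull π) (pull π)]
    refine (t1.add t2).mono fun y y' => ?_
    have h1 := ind_le_one (S i) y'
    have h0 : 0 ≤ ind (S i) y * ((θ₀ * o + r) * Real.exp (-(δ * g.dist y y'))) :=
      mul_nonneg (ind_nonneg _ _) (mul_nonneg (by positivity) (hE y y'))
    calc ind (S i) y * ind (S i) y' * (θ₀ * Real.exp (-(δ * g.dist y y'))) * o + ind (S i) y * ind (S i) y' * (r * Real.exp (-(δ * g.dist y y'))) * 1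
        = ind (S i) y' * (ind (S i) y * ((θ₀ * o + r) * Real.exp (-(δ * g.dist y y')))) := by ring
      _ ≤ 1 * (ind (S i) y * ((θ₀ * o + r) * Real.exp (-(δ * g.dist y y')))) := mul_le_mul_of_nonneg_right h1 h0
      _ = _ := one_mul _
  rw [remainder, remainder, idef_neg, idef_fsum]
  refine ((hasMaj_sum_overlap _ S _ Nov (fun y y' => mul_nonneg (by positivity) (hE y y')) hterm hN).neg).mono fun y y' => le_of_eq ?_
  ring

end Defects

/-! ## §5 The glued global propagator at two spacings, every letter cube-level ∕ partition-level -/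

section Glued

variable {X X' : Type} [Fintype X] [Fintype X'] [DecidableEq X] [DecidableEq X'] {ι : Type} [Fintype ι] {g : B6.Geometry} (blk : X → g.Site) (π : X' → X)
  (S : ι → Set g.Site) {σ cr : ℝ}

/-- ★★ **THE GLUED PROPAGATOR DECAYS, cube letters only**: `G = G₀(1 − R)⁻¹ ≤ N_ovβ·(1 − N_ovθ₀c_r)⁻¹c_r·e^{−(δ−σ)d}` under the ONE smallness `N_ov·θ₀·c_r < 1` —
[B6] Prop. 2.6 (2.136)'s first entry for the glued operator, with `θ₀ = O(M⁻¹)` the print's «M sufficiently large». [cite: Balaban1984PropagatorsII, Prop. 2.6 (2.136) p.247 (shape + mechanism)] -/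
theorem hasMaj_glued_of_cubes (htri : Triangle254 g) (hd : ∀ a b : g.Site, 0 ≤ g.dist a b) (hd0 : ∀ y : g.Site, g.dist y y = 0) (hrow : RowSum g σ cr) (hσ : 0 ≤ σ)
    {Δ : (X → ℝ) →ₗ[ℝ] (X → ℝ)} {h : ι → X → ℝ} {G : ι → (X → ℝ) →ₗ[ℝ] (X → ℝ)} {β θ₀ δ Nov : ℝ} (hβ : 0 ≤ β) (hθ : 0 ≤ θ₀) (hNov : 0 ≤ Nov) (hσδ : 2 * σ ≤ δ)
    (hh : ∀ i x, |h i x| ≤ 1) (hN : ∀ a, ∑ i, ind (S i) a ≤ Nov)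
    (hG : ∀ i, HasMaj (BlockNorm.ofBlocks g blk) (BlockNorm.ofBlocks g blk) (G i) (fun y y' => ind (S i) y * ind (S i) y' * (β * Real.exp (-(δ * g.dist y y')))))
    (hK : ∀ i, HasMaj (BlockNorm.ofBlocks g blk) (BlockNorm.ofBlocks g blk) (commOp Δ (h i) ∘ₗ G i)
      (fun y y' => ind (S i) y * ind (S i) y' * (θ₀ * Real.exp (-(δ * g.dist y y')))))
    (hq : Nov * θ₀ * cr < 1) :
    HasMaj (BlockNorm.ofBlocks g blk) (BlockNorm.ofBlocks g blk) (glueInv (parametrix h G) (remainder Δ h G))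
      (fun y y' => Nov * β * (1 - Nov * θ₀ * cr)⁻¹ * cr * Real.exp (-((δ - σ) * g.dist y y'))) :=
  hasMaj_glueInv blk htri hd hd0 hrow hσ (mul_nonneg hNov hβ) (mul_nonneg hNov hθ) hσδ (hasMaj_parametrix blk S hβ hh hN hG) (hasMaj_remainder blk S hθ hh hN hK) hq

/-- ★★★ **THE η-DEFECT OF THE GLUED GLOBAL PROPAGATOR FROM CUBE DATA.**  Cube-localized propagators `G_□, G_□′` with (2.133)-shaped majorants `β` and two-grid defects `m`,
commutator pieces `[Δ_a, M_{h_□}]G_□` with (2.134)-shaped majorants `θ₀` and two-grid defects `r`, all localized to reaches of overlap `≤ N_ov`, a quadratic partition with `|h_□|,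
|h′_□| ≤ 1` and fits `|h′_□ − h_□∘π| ≤ o`, and the ONE smallness `N_ov·θ₀·c_r < 1` ⟹ the glued propagators `G = G₀(1 − R)⁻¹`, `G′ = G₀′(1 − R′)⁻¹` (the inverses of `Δ_a`, `Δ_a′` by
`lap_comp_glued`) satisfy `𝔇(G′, G) ≤ C·e^{−(δ−2σ)d}` with `C` FILE 44's constant at `A = N_ovβ`, `θ = N_ovθ₀`, `m ↦ N_ov(2βo + m)`, `r ↦ N_ov(θ₀o + r)`.  This is the two-spacing
gluing: the η-rate of the GLOBAL propagator inherited from the η-rates of the CUBE propagators and of the partition — the step [Balaban1985BackgroundPropagators] p. 399 leaves to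
«generalized random walk expansions». [cite: Balaban1984PropagatorsII, (2.91) p.239, (2.133)–(2.136) p.247 (mechanism); Balaban1985BackgroundPropagators, p.399 (architecture), Thm 3.14 pp.426–427 (difference template)] -/
theorem hasMaj_idef_glued_of_cubes (htri : Triangle254 g) (hd : ∀ a b : g.Site, 0 ≤ g.dist a b) (hd0 : ∀ y : g.Site, g.dist y y = 0) (hrow : RowSum g σ cr) (hσ : 0 ≤ σ)
    (hcr : 0 ≤ cr) {Δ : (X → ℝ) →ₗ[ℝ] (X → ℝ)} {Δ' : (X' → ℝ) →ₗ[ℝ] (X' → ℝ)} {h : ι → X → ℝ} {h' : ι → X' → ℝ} {G : ι → (X → ℝ) →ₗ[ℝ] (X → ℝ)}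
    {G' : ι → (X' → ℝ) →ₗ[ℝ] (X' → ℝ)} {β θ₀ m r o δ Nov : ℝ} (hβ : 0 ≤ β) (hθ : 0 ≤ θ₀) (hm : 0 ≤ m) (hr : 0 ≤ r) (ho : 0 ≤ o) (hNov : 0 ≤ Nov) (hσδ : 2 * σ ≤ δ)
    (hh : ∀ i x, |h i x| ≤ 1) (hh' : ∀ i x', |h' i x'| ≤ 1) (hfit : ∀ i x', |h' i x' - h i (π x')| ≤ o) (hN : ∀ a, ∑ i, ind (S i) a ≤ Nov)
    (hG : ∀ i, HasMaj (BlockNorm.ofBlocks g blk) (BlockNorm.ofBlocks g blk) (G i) (fun y y' => ind (S i) y * ind (S i) y' * (β * Real.exp (-(δ * g.dist y y')))))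
    (hG' : ∀ i, HasMaj (BlockNorm.ofBlocks g (blk ∘ π)) (BlockNorm.ofBlocks g (blk ∘ π)) (G' i)
      (fun y y' => ind (S i) y * ind (S i) y' * (β * Real.exp (-(δ * g.dist y y')))))
    (hK : ∀ i, HasMaj (BlockNorm.ofBlocks g blk) (BlockNorm.ofBlocks g blk) (commOp Δ (h i) ∘ₗ G i)
      (fun y y' => ind (S i) y * ind (S i) y' * (θ₀ * Real.exp (-(δ * g.dist y y')))))
    (hK' : ∀ i, HasMaj (BlockNorm.ofBlocks g (blk ∘ π)) (BlockNorm.ofBlocks g (blk ∘ π)) (commOp Δ' (h' i) ∘ₗ G' i)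
      (fun y y' => ind (S i) y * ind (S i) y' * (θ₀ * Real.exp (-(δ * g.dist y y')))))
    (hDG : ∀ i, HasMaj (BlockNorm.ofBlocks g blk) (BlockNorm.ofBlocks g (blk ∘ π)) (idef (pull π) (pull π) (G' i) (G i))
      (fun y y' => ind (S i) y * ind (S i) y' * (m * Real.exp (-(δ * g.dist y y')))))
    (hDK : ∀ i, HasMaj (BlockNorm.ofBlocks g blk) (BlockNorm.ofBlocks g (blk ∘ π)) (idef (pull π) (pull π) (commOp Δ' (h' i) ∘ₗ G' i) (commOp Δ (h i) ∘ₗ G i))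
      (fun y y' => ind (S i) y * ind (S i) y' * (r * Real.exp (-(δ * g.dist y y')))))
    (hq : Nov * θ₀ * cr < 1) :
    HasMaj (BlockNorm.ofBlocks g blk) (BlockNorm.ofBlocks g (blk ∘ π))
      (idef (pull π) (pull π) (glueInv (parametrix h' G') (remainder Δ' h' G')) (glueInv (parametrix h G) (remainder Δ h G)))
      (fun y y' => (Nov * β * ((1 - Nov * θ₀ * cr)⁻¹ * ((1 - Nov * θ₀ * cr)⁻¹ * (Nov * (θ₀ * o + r)) * cr) * cr) * cr +
        Nov * (2 * β * o + m) * (1 - Nov * θ₀ * cr)⁻¹ * cr) * Real.exp (-((δ - 2 * σ) * g.dist y y'))) :=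
  hasMaj_idef_glueInv blk π htri hd hd0 hrow hσ hcr (mul_nonneg hNov hβ) (mul_nonneg hNov hθ) (mul_nonneg hNov (by positivity)) (mul_nonneg hNov (by positivity)) hσδ
    (hasMaj_parametrix (blk ∘ π) S hβ hh' hN hG') (hasMaj_remainder blk S hθ hh hN hK) (hasMaj_remainder (blk ∘ π) S hθ hh' hN hK')
    (hasMaj_idef_parametrix blk π S hβ hm ho hh hh' hfit hN hG hG' hDG) (hasMaj_idef_remainder blk π S hθ hr ho hh hfit hN hK' hDK) hq

/-- **THE `M`-LIVE READING**: with (2.134)'s `θ₀ = κ₀∕M` and `M ≥ 2N_ovκ₀c_r`, `M > 0`, the smallness holds and the Neumann constant is `≤ 2` — [B9] Thm 3.1's «for M ≥ M₁» as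
the convergence of the expansion, here `M₁ = 2N_ovκ₀c_r`. [cite: Balaban1984PropagatorsII, (2.134)–(2.135) p.247; Balaban1985BackgroundPropagators, Thm 3.1 p.397 (the guard `M ≥ M₁`)] -/
theorem glued_smallness_of_M {κ₀ M Nov : ℝ} (hM : 0 < M) (hMge : 2 * (Nov * κ₀) * cr ≤ M) :
    Nov * (κ₀ / M) * cr < 1 ∧ (1 - Nov * (κ₀ / M) * cr)⁻¹ ≤ 2 := by
  have h := inv_one_sub_le_two_of_M (cr := cr) (κ₀ := Nov * κ₀) hM hMge
  rw [show Nov * (κ₀ / M) = Nov * κ₀ / M by ring]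
  exact h

end Glued

end Summit.QuantumFields.YangMills.BalabanUVNodes.N15.Gluing

end
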